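import Summits.QuantumAdvantage.QuantumAdvantage.Theorems.CubicForrelationNearExactIsExactTwelveLevelFiveOffHyperplaneAt2932
import Summits.QuantumAdvantage.QuantumAdvantage.Theorems.CubicForrelationNearExactIsExactTwelveLevelFiveDuality
import Summits.QuantumAdvantage.QuantumAdvantage.Theorems.CubicForrelationNearExactIsExactEvenSectionsMinWeightFlat

/-!
# Crux `CubicForrelation.NearExactIsExact` (stmt-QuantumAdvantage-14043) — n = 12 AT `Φ = 29/32`, configuration (c) of a level-5 side:
  the `±2`-set is an 8-FLAT `p ⊕ U` and the signs on it are MULTIPLICATIVE (affine)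

Certificate seat `b2b-cforr-cert` (gen 23).  HONEST FRAMING: kernel-checked finite-slice structure lemmas (standard axioms, no `decide`) about cubic
Boolean pairs on 12 bits.  NO new value of `θ₁₂`; NOT summit progress.

Setting (`l5t_layer2`): cubic `f, g`, `W_g = 32u'` with some `u'(x)` odd, `Φ(f,g) ≥ 29/32`, odd set `P = x_P ⊕ V`, even set `P' = x' ⊕ V`,
residual `e = u' − 2(−1)^f` with `e/2` odd somewhere on `P'`.  Then `A = {x ∈ P' : e/2 odd}` has `256` points, `e² = 4` on `A`, `e = 0` on
`P' ∖ A`, and `A` has even sections on parametrised 4-flats of `P'`.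
1. (`cc_flat`) By the even-section form of "minimum-weight words are flats" (`emf_flat_of_even_sections`, `2³·256 = 2¹¹`) the periods
   `U = {a ∈ V : A ⊕ a = A}` form a group of order `256` and `A = p ⊕ U` for every `p ∈ A`.
2. (`cc_dirs_exist`) There are periods `d₁, d₂, d₃ ∈ V` independent modulo `U` (counting cosets).
3. (`cc_signs`) For `p ∈ A`, `u₁, u₂ ∈ U` the 5-flat `p ⊕ ⟨d₁,d₂,d₃,u₁,u₂⟩ ⊂ P'` meets `A` exactly in the 2-flat `p ⊕ ⟨u₁,u₂⟩`, and
   `Σ e ≡ 0 (mod 8)` over it (`l5c_flat5`); so the four values `e = ±2` on the 2-flat have product `+16`: the sign of `e` is multiplicative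
   (affine) along `U`.

References: MacWilliams–Sloane (1977) Ch. 13 §4; Ax (1964) / McEliece (1972).  Axioms: the standard three.
-/

set_option linter.dupNamespace false -- D-0017: single-problem summit ⇒ `QuantumAdvantage.QuantumAdvantage` by design

noncomputable section

namespace Summit.QuantumAdvantage.QuantumAdvantage.Theorems.CubicForrelation.NearExactIsExact

open Finset
open Literature.Computability.QuantumComplexity
open Literature.Computability.QuantumComplexity.BuzetChailloux (bxor zeroVec bxor_bxor_cancel_left bxor_zeroVec zeroVec_bxor bxor_comm
  bxor_self)
open Literature.Computability.QuantumComplexity.DerivativeWalsh (W)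

/-! ### Small tools on parametrised flats -/

/-- A parametrised flat with no directions is its base point: `Σ_{ε : 𝔽₂⁰} F(w ⊕ ε·a) = F(w)`. [folklore] -/
theorem cc_sum_zero_dirs {n : ℕ} {M : Type*} [AddCommMonoid M] (F : (Fin n → Bool) → M) (w : Fin n → Bool)
    (a : Fin 0 → Fin n → Bool) :
    ∑ ε : Fin 0 → Bool, F (fun j => w j ^^ decide (Odd #(univ.filter fun i => ε i && a i j))) = F w := by
  rw [Fintype.sum_unique]
  congr 1
  funext j
  simp [Finset.univ_eq_empty]

/-- The parametrised 2-flat sum, explicitly: `F(w) + F(w ⊕ u₂) + (F(w ⊕ u₁) + F(w ⊕ u₁ ⊕ u₂))`. [folklore] -/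
theorem cc_sum_two {n : ℕ} {M : Type*} [AddCommMonoid M] (F : (Fin n → Bool) → M) (w u₁ u₂ : Fin n → Bool)
    (a₀ : Fin 0 → Fin n → Bool) :
    ∑ ε : Fin (1 + 1) → Bool, F (fun j => w j ^^ decide (Odd #(univ.filter fun i : Fin (1 + 1) => ε i && (Fin.cons u₁ (Fin.cons u₂ a₀) : Fin (1 + 1) → Fin n → Bool) i j))) =
      F w + F (bxor w u₂) + (F (bxor w u₁) + F (bxor (bxor w u₁) u₂)) := by
  rw [l5c_sum_split F w u₁ (Fin.cons u₂ a₀), l5c_sum_split F w u₂ a₀, l5c_sum_split F (bxor w u₁) u₂ a₀,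
    cc_sum_zero_dirs, cc_sum_zero_dirs, cc_sum_zero_dirs, cc_sum_zero_dirs]

/-- `p ⊕ (p ⊕ a ⊕ b) = a ⊕ b`. [folklore] -/
theorem cc_cancel2 {n : ℕ} (p a b : Fin n → Bool) : bxor p (bxor (bxor p a) b) = bxor a b := by
  funext j; simp only [bxor]; cases p j <;> cases a j <;> cases b j <;> rfl

/-- `p ⊕ (p ⊕ a ⊕ b ⊕ c) = a ⊕ b ⊕ c`. [folklore] -/
theorem cc_cancel3 {n : ℕ} (p a b c : Fin n → Bool) : bxor p (bxor (bxor (bxor p a) b) c) = bxor (bxor a b) c := by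
  funext j; simp only [bxor]; cases p j <;> cases a j <;> cases b j <;> cases c j <;> rfl

/-- If `t ∉ d ⊕ U` then `d ⊕ t ∉ U`. [folklore] -/
theorem cc_notMem_of {n : ℕ} (U : Finset (Fin n → Bool)) {d t : Fin n → Bool} (h : t ∉ U.image (bxor d)) : bxor d t ∉ U :=
  fun hm => h (mem_image.2 ⟨bxor d t, hm, bxor_bxor_cancel_left d t⟩)

/-- A point `w` with `p ⊕ w ∉ U` has its whole `U`-coset off `A = p ⊕ U`. [folklore] -/
theorem cc_far {n : ℕ} (U A : Finset (Fin n → Bool)) (hUadd : ∀ a ∈ U, ∀ b ∈ U, bxor a b ∈ U) (p w : Fin n → Bool)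
    (hA : A = U.image (bxor p)) (hw : bxor p w ∉ U) : ∀ u ∈ U, bxor w u ∉ A := by
  intro u hu hmem
  rw [hA] at hmem
  obtain ⟨v, hv, he⟩ := mem_image.1 hmem
  have e : bxor p w = bxor v u := by
    funext j
    have h := congrFun he j
    simp only [bxor] at h ⊢
    revert h
    cases p j <;> cases w j <;> cases u j <;> cases v j <;> decide
  exact hw (e ▸ hUadd v hv u hu)

/-! ### 1. The `±2`-set of configuration (c) is an 8-flat -/

/-- **Configuration (c): the `±2`-set is an 8-flat.**  In the setting of the module docstring, the period group `U ⊆ V` of `A` contains `0`,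
is `⊕`-closed, has `256` elements, and `A = p ⊕ U` for every `p ∈ A`. [this work] -/
theorem cc_flat (f g : (Fin (6 + 6) → Bool) → Bool) (hf : IsDegLeFun 3 f) (hg : IsDegLeFun 3 g)
    (u' : (Fin (6 + 6) → Bool) → ℤ) (hu' : ∀ x, W (fun y => signOf (g y)) x = (2 : ℝ) ^ 5 * (u' x : ℝ))
    (hodd : ∃ x, Odd (u' x)) (hΦ : (29 / 32 : ℝ) ≤ forrelation f g)
    (h2 : ∃ x, ¬ Odd (u' x) ∧ Odd ((u' x - 2 * sZ (f x)) / 2))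
    (V : Finset (Fin (6 + 6) → Bool)) (xP x' : Fin (6 + 6) → Bool) (h0 : zeroVec ∈ V) (hadd : ∀ a ∈ V, ∀ b ∈ V, bxor a b ∈ V)
    (hcardV : #V = 2 ^ 11)
    (hS : (univ.filter fun x : Fin (6 + 6) → Bool => Odd (u' x)) = V.image (bxor xP))
    (hS' : (univ.filter fun x : Fin (6 + 6) → Bool => ¬ Odd (u' x)) = V.image (bxor x')) :
    zeroVec ∈ (V.filter fun a => ∀ x ∈ ((univ.filter fun x : Fin (6 + 6) → Bool => ¬ Odd (u' x)).filter fun x => Odd ((u' x - 2 * sZ (f x)) / 2)), bxor x a ∈ ((univ.filter fun x : Fin (6 + 6) → Bool => ¬ Odd (u' x)).filter fun x => Odd ((u' x - 2 * sZ (f x)) / 2))) ∧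
    (∀ a ∈ (V.filter fun a => ∀ x ∈ ((univ.filter fun x : Fin (6 + 6) → Bool => ¬ Odd (u' x)).filter fun x => Odd ((u' x - 2 * sZ (f x)) / 2)), bxor x a ∈ ((univ.filter fun x : Fin (6 + 6) → Bool => ¬ Odd (u' x)).filter fun x => Odd ((u' x - 2 * sZ (f x)) / 2))), ∀ b ∈ (V.filter fun a => ∀ x ∈ ((univ.filter fun x : Fin (6 + 6) → Bool => ¬ Odd (u' x)).filter fun x => Odd ((u' x - 2 * sZ (f x)) / 2)), bxor x a ∈ ((univ.filter fun x : Fin (6 + 6) → Bool => ¬ Odd (u' x)).filter fun x => Odd ((u' x - 2 * sZ (f x)) / 2))), bxor a b ∈ (V.filter fun a => ∀ x ∈ ((univ.filter fun x : Fin (6 + 6) → Bool => ¬ Odd (u' x)).filter fun x => Odd ((u' x - 2 * sZ (f x)) / 2)), bxor x a ∈ ((univ.filter fun x : Fin (6 + 6) → Bool => ¬ Odd (u' x)).filter fun x => Odd ((u' x - 2 * sZ (f x)) / 2)))) ∧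
    #(V.filter fun a => ∀ x ∈ ((univ.filter fun x : Fin (6 + 6) → Bool => ¬ Odd (u' x)).filter fun x => Odd ((u' x - 2 * sZ (f x)) / 2)), bxor x a ∈ ((univ.filter fun x : Fin (6 + 6) → Bool => ¬ Odd (u' x)).filter fun x => Odd ((u' x - 2 * sZ (f x)) / 2))) = 256 ∧
    ∀ p ∈ ((univ.filter fun x : Fin (6 + 6) → Bool => ¬ Odd (u' x)).filter fun x => Odd ((u' x - 2 * sZ (f x)) / 2)), ((univ.filter fun x : Fin (6 + 6) → Bool => ¬ Odd (u' x)).filter fun x => Odd ((u' x - 2 * sZ (f x)) / 2)) = (V.filter fun a => ∀ x ∈ ((univ.filter fun x : Fin (6 + 6) → Bool => ¬ Odd (u' x)).filter fun x => Odd ((u' x - 2 * sZ (f x)) / 2)), bxor x a ∈ ((univ.filter fun x : Fin (6 + 6) → Bool => ¬ Odd (u' x)).filter fun x => Odd ((u' x - 2 * sZ (f x)) / 2))).image (bxor p) := by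
  classical
  obtain ⟨hA256, -, -, -, heven'⟩ := l5t_layer2 f g hf hg u' hu' hodd hΦ h2
  have hmemP' : ∀ x, x ∈ V.image (bxor x') ↔ ¬ Odd (u' x) := fun x => by rw [← hS']; simp
  have hPV' : ∀ x, x ∈ V.image (bxor x') → ∀ a ∈ V, bxor x a ∈ V.image (bxor x') :=
    fun x hx a ha => fl1_coset_vadd hadd rfl hx ha
  have hAsub : ((univ.filter fun x : Fin (6 + 6) → Bool => ¬ Odd (u' x)).filter fun x => Odd ((u' x - 2 * sZ (f x)) / 2)) ⊆ V.image (bxor x') := by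
    intro x hx; rw [← hS']; exact (mem_filter.1 hx).1
  have heven : ∀ b ∈ V.image (bxor x'), ∀ a : Fin (2 + 1 + 1) → Fin (6 + 6) → Bool, (∀ i, a i ∈ V) →
      Even #(univ.filter fun ε : Fin (2 + 1 + 1) → Bool => (fun j => b j ^^ decide (Odd #(univ.filter fun i => ε i && a i j))) ∈ ((univ.filter fun x : Fin (6 + 6) → Bool => ¬ Odd (u' x)).filter fun x => Odd ((u' x - 2 * sZ (f x)) / 2))) := by
    intro b hb a ha
    have hb' : ¬ Odd (u' b) := (hmemP' b).1 hb
    have hdir : ∀ i x, (Odd (u' (bxor x (a i))) ↔ Odd (u' x)) := fun i => (l5k_memV u' V xP x' h0 hadd hS hS' (a i)).1 (ha i)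
    have h := heven' b hb' a hdir
    have e : (univ.filter fun ε : Fin (2 + 1 + 1) → Bool => (fun j => b j ^^ decide (Odd #(univ.filter fun i => ε i && a i j))) ∈ ((univ.filter fun x : Fin (6 + 6) → Bool => ¬ Odd (u' x)).filter fun x => Odd ((u' x - 2 * sZ (f x)) / 2))) =
        univ.filter fun ε : Fin 4 → Bool => Odd ((u' (fun j => b j ^^ decide (Odd #(univ.filter fun i => ε i && a i j))) - 2 * sZ (f (fun j => b j ^^ decide (Odd #(univ.filter fun i => ε i && a i j))))) / 2) := by
      refine filter_congr fun ε _ => ?_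
      rw [mem_filter]
      have hm : (fun j => b j ^^ decide (Odd #(univ.filter fun i => ε i && a i j))) ∈ (univ.filter fun x : Fin (6 + 6) → Bool => ¬ Odd (u' x)) := by
        rw [hS']; exact ws_flatPt_mem V h0 (fun z => z ∈ V.image (bxor x')) hPV' 4 b hb a ha ε
      exact ⟨fun h' => h'.2, fun h' => ⟨hm, h'⟩⟩
    rw [e]; exact h
  have hcardA : 2 ^ (2 + 1) * #((univ.filter fun x : Fin (6 + 6) → Bool => ¬ Odd (u' x)).filter fun x => Odd ((u' x - 2 * sZ (f x)) / 2)) = 2 ^ 11 := by rw [hA256]; norm_num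
  obtain ⟨hU0, hUadd, hUcard, hcos⟩ := emf_flat_of_even_sections 11 2 V h0 hadd hcardV x' _ hAsub heven hcardA
  exact ⟨hU0, hUadd, by rw [hUcard, hA256], hcos⟩

/-! ### 2. Three periods independent modulo `U` -/

/-- **Three directions of `V` independent modulo `U`**: since `#V = 2048 = 8·#U`, there are `d₁, d₂, d₃ ∈ V` none of whose seven non-trivial
combinations lies in `U`. [folklore] -/
theorem cc_dirs_exist (V U : Finset (Fin (6 + 6) → Bool)) (hUV : U ⊆ V) (hcardV : #V = 2 ^ 11) (hcardU : #U = 256) :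
    ∃ d₁ ∈ V, ∃ d₂ ∈ V, ∃ d₃ ∈ V, d₁ ∉ U ∧ d₂ ∉ U ∧ bxor d₁ d₂ ∉ U ∧ d₃ ∉ U ∧ bxor d₁ d₃ ∉ U ∧ bxor d₂ d₃ ∉ U ∧
      bxor (bxor d₁ d₂) d₃ ∉ U := by
  classical
  have hci : ∀ d : Fin (6 + 6) → Bool, #(U.image (bxor d)) = 256 := fun d => by
    rw [card_image_of_injective _ (fun y y' hyy => by
      have h' := congrArg (bxor d) hyy
      rwa [bxor_bxor_cancel_left, bxor_bxor_cancel_left] at h'), hcardU]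
  have _hUV := hUV
  obtain ⟨d₁, hd₁V, hd₁⟩ : ∃ d, d ∈ V ∧ d ∉ U := exists_mem_notMem_of_card_lt_card (by rw [hcardU, hcardV]; norm_num)
  obtain ⟨d₂, hd₂V, hd₂⟩ : ∃ d, d ∈ V ∧ d ∉ U ∪ U.image (bxor d₁) :=
    exists_mem_notMem_of_card_lt_card (lt_of_le_of_lt (card_union_le _ _) (by rw [hcardU, hci, hcardV]; norm_num))
  obtain ⟨d₃, hd₃V, hd₃⟩ : ∃ d, d ∈ V ∧ d ∉ (U ∪ U.image (bxor d₁)) ∪ (U.image (bxor d₂) ∪ U.image (bxor (bxor d₁ d₂))) :=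
    exists_mem_notMem_of_card_lt_card (lt_of_le_of_lt (card_union_le _ _) (lt_of_le_of_lt
      (Nat.add_le_add (card_union_le _ _) (card_union_le _ _)) (by rw [hcardU, hci, hci, hci, hcardV]; norm_num)))
  simp only [mem_union, not_or] at hd₂ hd₃
  exact ⟨d₁, hd₁V, d₂, hd₂V, d₃, hd₃V, hd₁, hd₂.1, cc_notMem_of U hd₂.2, hd₃.1.1, cc_notMem_of U hd₃.1.2,
    cc_notMem_of U hd₃.2.1, cc_notMem_of U hd₃.2.2⟩

/-! ### 3. Multiplicativity of the signs on `A` -/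

/-- **Sums over parametrised flats in a `U`-coset of `P'` off `A` vanish**: if `w ∈ P'` has `w ⊕ U` disjoint from `A` and the directions lie
in `U`, then `Σ_ε e(w ⊕ ε·a) = 0` (`e = 0` on `P' ∖ A`). [this work] -/
theorem cc_sum_vanish (f g : (Fin (6 + 6) → Bool) → Bool) (hf : IsDegLeFun 3 f) (hg : IsDegLeFun 3 g)
    (u' : (Fin (6 + 6) → Bool) → ℤ) (hu' : ∀ x, W (fun y => signOf (g y)) x = (2 : ℝ) ^ 5 * (u' x : ℝ))
    (hodd : ∃ x, Odd (u' x)) (hΦ : (29 / 32 : ℝ) ≤ forrelation f g)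
    (h2 : ∃ x, ¬ Odd (u' x) ∧ Odd ((u' x - 2 * sZ (f x)) / 2))
    (V : Finset (Fin (6 + 6) → Bool)) (xP x' : Fin (6 + 6) → Bool) (h0 : zeroVec ∈ V) (hadd : ∀ a ∈ V, ∀ b ∈ V, bxor a b ∈ V)
    (hcardV : #V = 2 ^ 11)
    (hS : (univ.filter fun x : Fin (6 + 6) → Bool => Odd (u' x)) = V.image (bxor xP))
    (hS' : (univ.filter fun x : Fin (6 + 6) → Bool => ¬ Odd (u' x)) = V.image (bxor x'))
    {k : ℕ} (w : Fin (6 + 6) → Bool) (hw : ¬ Odd (u' w)) (hfar : ∀ u ∈ (V.filter fun a => ∀ x ∈ ((univ.filter fun x : Fin (6 + 6) → Bool => ¬ Odd (u' x)).filter fun x => Odd ((u' x - 2 * sZ (f x)) / 2)), bxor x a ∈ ((univ.filter fun x : Fin (6 + 6) → Bool => ¬ Odd (u' x)).filter fun x => Odd ((u' x - 2 * sZ (f x)) / 2))), bxor w u ∉ ((univ.filter fun x : Fin (6 + 6) → Bool => ¬ Odd (u' x)).filter fun x => Odd ((u' x - 2 * sZ (f x)) / 2)))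
    (a : Fin k → Fin (6 + 6) → Bool) (ha : ∀ i, a i ∈ (V.filter fun a => ∀ x ∈ ((univ.filter fun x : Fin (6 + 6) → Bool => ¬ Odd (u' x)).filter fun x => Odd ((u' x - 2 * sZ (f x)) / 2)), bxor x a ∈ ((univ.filter fun x : Fin (6 + 6) → Bool => ¬ Odd (u' x)).filter fun x => Odd ((u' x - 2 * sZ (f x)) / 2)))) :
    ∑ ε : Fin k → Bool, (u' (fun j => w j ^^ decide (Odd #(univ.filter fun i => ε i && a i j))) - 2 * sZ (f (fun j => w j ^^ decide (Odd #(univ.filter fun i => ε i && a i j))))) = 0 := by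
  classical
  obtain ⟨-, -, hzero, -, -⟩ := l5t_layer2 f g hf hg u' hu' hodd hΦ h2
  obtain ⟨hU0, hUadd, -, -⟩ := cc_flat f g hf hg u' hu' hodd hΦ h2 V xP x' h0 hadd hcardV hS hS'
  refine sum_eq_zero fun ε _ => ?_
  have hu : (fun j => zeroVec j ^^ decide (Odd #(univ.filter fun i => ε i && a i j))) ∈ (V.filter fun a => ∀ x ∈ ((univ.filter fun x : Fin (6 + 6) → Bool => ¬ Odd (u' x)).filter fun x => Odd ((u' x - 2 * sZ (f x)) / 2)), bxor x a ∈ ((univ.filter fun x : Fin (6 + 6) → Bool => ¬ Odd (u' x)).filter fun x => Odd ((u' x - 2 * sZ (f x)) / 2))) :=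
    ws_flatPt_mem _ hU0 (fun z => z ∈ (V.filter fun a => ∀ x ∈ ((univ.filter fun x : Fin (6 + 6) → Bool => ¬ Odd (u' x)).filter fun x => Odd ((u' x - 2 * sZ (f x)) / 2)), bxor x a ∈ ((univ.filter fun x : Fin (6 + 6) → Bool => ¬ Odd (u' x)).filter fun x => Odd ((u' x - 2 * sZ (f x)) / 2)))) (fun z hz b hb => hUadd z hz b hb) k zeroVec hU0 a ha ε
  rw [ws_flatPt_eq_bxor w a ε]
  have hV : (fun j => zeroVec j ^^ decide (Odd #(univ.filter fun i => ε i && a i j))) ∈ V := (mem_filter.1 hu).1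
  have hw' : ¬ Odd (u' (bxor w (fun j => zeroVec j ^^ decide (Odd #(univ.filter fun i => ε i && a i j))))) := by
    rw [(l5k_memV u' V xP x' h0 hadd hS hS' _).1 hV w]; exact hw
  refine hzero _ hw' fun hodd' => hfar _ hu ?_
  exact mem_filter.2 ⟨mem_filter.2 ⟨mem_univ _, hw'⟩, hodd'⟩

/-- **The signs of `e` on the 8-flat `A` are multiplicative**: for `p ∈ A` and periods `u₁, u₂ ∈ U`,
`e(p)·e(p⊕u₁)·e(p⊕u₂)·e(p⊕u₁⊕u₂) = 16` (all four values are `±2` with an even number of minus signs).  From `Σ e ≡ 0 (mod 8)` over the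
5-flat `p ⊕ ⟨d₁,d₂,d₃,u₁,u₂⟩ ⊂ P'`, which meets `A` exactly in the 2-flat `p ⊕ ⟨u₁,u₂⟩`. [this work] -/
theorem cc_signs (f g : (Fin (6 + 6) → Bool) → Bool) (hf : IsDegLeFun 3 f) (hg : IsDegLeFun 3 g)
    (u' : (Fin (6 + 6) → Bool) → ℤ) (hu' : ∀ x, W (fun y => signOf (g y)) x = (2 : ℝ) ^ 5 * (u' x : ℝ))
    (hodd : ∃ x, Odd (u' x)) (hΦ : (29 / 32 : ℝ) ≤ forrelation f g)
    (h2 : ∃ x, ¬ Odd (u' x) ∧ Odd ((u' x - 2 * sZ (f x)) / 2))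
    (V : Finset (Fin (6 + 6) → Bool)) (xP x' : Fin (6 + 6) → Bool) (h0 : zeroVec ∈ V) (hadd : ∀ a ∈ V, ∀ b ∈ V, bxor a b ∈ V)
    (hcardV : #V = 2 ^ 11)
    (hS : (univ.filter fun x : Fin (6 + 6) → Bool => Odd (u' x)) = V.image (bxor xP))
    (hS' : (univ.filter fun x : Fin (6 + 6) → Bool => ¬ Odd (u' x)) = V.image (bxor x'))
    (p : Fin (6 + 6) → Bool) (hp : p ∈ ((univ.filter fun x : Fin (6 + 6) → Bool => ¬ Odd (u' x)).filter fun x => Odd ((u' x - 2 * sZ (f x)) / 2)))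
    (u₁ u₂ : Fin (6 + 6) → Bool) (hu₁ : u₁ ∈ (V.filter fun a => ∀ x ∈ ((univ.filter fun x : Fin (6 + 6) → Bool => ¬ Odd (u' x)).filter fun x => Odd ((u' x - 2 * sZ (f x)) / 2)), bxor x a ∈ ((univ.filter fun x : Fin (6 + 6) → Bool => ¬ Odd (u' x)).filter fun x => Odd ((u' x - 2 * sZ (f x)) / 2)))) (hu₂ : u₂ ∈ (V.filter fun a => ∀ x ∈ ((univ.filter fun x : Fin (6 + 6) → Bool => ¬ Odd (u' x)).filter fun x => Odd ((u' x - 2 * sZ (f x)) / 2)), bxor x a ∈ ((univ.filter fun x : Fin (6 + 6) → Bool => ¬ Odd (u' x)).filter fun x => Odd ((u' x - 2 * sZ (f x)) / 2)))) :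
    (u' p - 2 * sZ (f p)) * (u' (bxor p u₂) - 2 * sZ (f (bxor p u₂))) * ((u' (bxor p u₁) - 2 * sZ (f (bxor p u₁))) * (u' (bxor (bxor p u₁) u₂) - 2 * sZ (f (bxor (bxor p u₁) u₂)))) = 16 := by
  classical
  obtain ⟨-, hfour, -, -, -⟩ := l5t_layer2 f g hf hg u' hu' hodd hΦ h2
  obtain ⟨hU0, hUadd, hUcard, hcos⟩ := cc_flat f g hf hg u' hu' hodd hΦ h2 V xP x' h0 hadd hcardV hS hS'
  have hUV : (V.filter fun a => ∀ x ∈ ((univ.filter fun x : Fin (6 + 6) → Bool => ¬ Odd (u' x)).filter fun x => Odd ((u' x - 2 * sZ (f x)) / 2)), bxor x a ∈ ((univ.filter fun x : Fin (6 + 6) → Bool => ¬ Odd (u' x)).filter fun x => Odd ((u' x - 2 * sZ (f x)) / 2))) ⊆ V := filter_subset _ _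
  obtain ⟨d₁, hd₁V, d₂, hd₂V, d₃, hd₃V, hd₁, hd₂, hd₁₂, hd₃, hd₁₃, hd₂₃, hd₁₂₃⟩ := cc_dirs_exist V _ hUV hcardV hUcard
  have hA := hcos p hp
  have hpP' : ¬ Odd (u' p) := (mem_filter.1 (mem_filter.1 hp).1).2
  have hmemV := fun a => l5k_memV u' V xP x' h0 hadd hS hS' a
  -- translates of the even point `p` by periods are even
  have hev : ∀ w, ¬ Odd (u' w) → ∀ d ∈ V, ¬ Odd (u' (bxor w d)) := fun w hw d hd => by rw [(hmemV d).1 hd w]; exact hw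
  -- the 5-flat sum, split along `d₁, d₂, d₃`
  set e : (Fin (6 + 6) → Bool) → ℤ := fun x => u' x - 2 * sZ (f x) with hedef
  have h5 := l5c_flat5 f g hf hg u' hu' p (Fin.cons d₁ (Fin.cons d₂ (Fin.cons d₃ (Fin.cons u₁ (Fin.cons u₂ (fun _ => zeroVec))))))
  change (8 : ℤ) ∣ ∑ ε : Fin (4 + 1) → Bool, e (fun j => p j ^^ decide (Odd #(univ.filter fun i : Fin (4 + 1) =>
      ε i && (Fin.cons d₁ (Fin.cons d₂ (Fin.cons d₃ (Fin.cons u₁ (Fin.cons u₂ (fun _ => zeroVec))))) :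
        Fin (4 + 1) → Fin (6 + 6) → Bool) i j))) at h5
  rw [l5c_sum_split e p d₁, l5c_sum_split e p d₂, l5c_sum_split e (bxor p d₁) d₂,
    l5c_sum_split e p d₃, l5c_sum_split e (bxor p d₂) d₃, l5c_sum_split e (bxor p d₁) d₃,
    l5c_sum_split e (bxor (bxor p d₁) d₂) d₃] at h5
  -- the seven translated 2-flat sums vanish
  have hdirs : ∀ i, (Fin.cons u₁ (Fin.cons u₂ (fun _ => zeroVec)) : Fin (1 + 1) → Fin (6 + 6) → Bool) i ∈ (V.filter fun a => ∀ x ∈ ((univ.filter fun x : Fin (6 + 6) → Bool => ¬ Odd (u' x)).filter fun x => Odd ((u' x - 2 * sZ (f x)) / 2)), bxor x a ∈ ((univ.filter fun x : Fin (6 + 6) → Bool => ¬ Odd (u' x)).filter fun x => Odd ((u' x - 2 * sZ (f x)) / 2))) := by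
    intro i
    refine Fin.cases ?_ (fun i => ?_) i
    · simpa using hu₁
    · refine Fin.cases ?_ (fun i => i.elim0) i
      simpa using hu₂
  have van : ∀ w, ¬ Odd (u' w) → bxor p w ∉ (V.filter fun a => ∀ x ∈ ((univ.filter fun x : Fin (6 + 6) → Bool => ¬ Odd (u' x)).filter fun x => Odd ((u' x - 2 * sZ (f x)) / 2)), bxor x a ∈ ((univ.filter fun x : Fin (6 + 6) → Bool => ¬ Odd (u' x)).filter fun x => Odd ((u' x - 2 * sZ (f x)) / 2))) →
      ∑ ε : Fin (1 + 1) → Bool, e (fun j => w j ^^ decide (Odd #(univ.filter fun i : Fin (1 + 1) =>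
        ε i && (Fin.cons u₁ (Fin.cons u₂ (fun _ => zeroVec)) : Fin (1 + 1) → Fin (6 + 6) → Bool) i j))) = 0 :=
    fun w hw hpw => cc_sum_vanish f g hf hg u' hu' hodd hΦ h2 V xP x' h0 hadd hcardV hS hS' w hw (cc_far _ _ hUadd p w hA hpw) _ hdirs
  have hw1 : ¬ Odd (u' (bxor p d₁)) := hev p hpP' d₁ hd₁V
  have hw2 : ¬ Odd (u' (bxor p d₂)) := hev p hpP' d₂ hd₂V
  have hw12 : ¬ Odd (u' (bxor (bxor p d₁) d₂)) := hev _ hw1 d₂ hd₂V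
  rw [van (bxor p d₃) (hev p hpP' d₃ hd₃V) (by rw [bxor_bxor_cancel_left]; exact hd₃),
    van (bxor p d₂) hw2 (by rw [bxor_bxor_cancel_left]; exact hd₂),
    van (bxor (bxor p d₂) d₃) (hev _ hw2 d₃ hd₃V) (by rw [cc_cancel2]; exact hd₂₃),
    van (bxor p d₁) hw1 (by rw [bxor_bxor_cancel_left]; exact hd₁),
    van (bxor (bxor p d₁) d₃) (hev _ hw1 d₃ hd₃V) (by rw [cc_cancel2]; exact hd₁₃),
    van (bxor (bxor p d₁) d₂) hw12 (by rw [cc_cancel2]; exact hd₁₂),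
    van (bxor (bxor (bxor p d₁) d₂) d₃) (hev _ hw12 d₃ hd₃V) (by rw [cc_cancel3]; exact hd₁₂₃)] at h5
  simp only [add_zero] at h5
  rw [cc_sum_two] at h5
  -- the four values on the 2-flat are `±2`
  have hpm : ∀ x ∈ ((univ.filter fun x : Fin (6 + 6) → Bool => ¬ Odd (u' x)).filter fun x => Odd ((u' x - 2 * sZ (f x)) / 2)), e x = 2 ∨ e x = -2 := by
    intro x hx
    have hx1 := mem_filter.1 hx
    have hsq : e x ^ 2 = 4 := hfour x (mem_filter.1 hx1.1).2 hx1.2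
    have : (e x - 2) * (e x + 2) = 0 := by nlinarith
    rcases mul_eq_zero.1 this with h | h
    · left; linarith
    · right; linarith
  have hin : ∀ u ∈ (V.filter fun a => ∀ x ∈ ((univ.filter fun x : Fin (6 + 6) → Bool => ¬ Odd (u' x)).filter fun x => Odd ((u' x - 2 * sZ (f x)) / 2)), bxor x a ∈ ((univ.filter fun x : Fin (6 + 6) → Bool => ¬ Odd (u' x)).filter fun x => Odd ((u' x - 2 * sZ (f x)) / 2))), bxor p u ∈ ((univ.filter fun x : Fin (6 + 6) → Bool => ¬ Odd (u' x)).filter fun x => Odd ((u' x - 2 * sZ (f x)) / 2)) := fun u hu => by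
    rw [hA]; exact mem_image.2 ⟨u, hu, rfl⟩
  have m0 := hpm p hp
  have m2 := hpm _ (hin u₂ hu₂)
  have m1 := hpm _ (hin u₁ hu₁)
  have m12 : e (bxor (bxor p u₁) u₂) = 2 ∨ e (bxor (bxor p u₁) u₂) = -2 := by
    rw [iw_bxor_assoc]; exact hpm _ (hin _ (hUadd u₁ hu₁ u₂ hu₂))
  have key : ∀ a b c d : ℤ, (a = 2 ∨ a = -2) → (b = 2 ∨ b = -2) → (c = 2 ∨ c = -2) → (d = 2 ∨ d = -2) →
      (8 : ℤ) ∣ a + b + (c + d) → a * b * (c * d) = 16 := by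
    intro a b c d ha hb hc hd h8
    rcases ha with rfl | rfl <;> rcases hb with rfl | rfl <;> rcases hc with rfl | rfl <;> rcases hd with rfl | rfl <;> omega
  exact key _ _ _ _ m0 m2 m1 m12 h5

end Summit.QuantumAdvantage.QuantumAdvantage.Theorems.CubicForrelation.NearExactIsExact

end
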